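import Summits.CriticalPhenomena.PercolationContinuityZ3.Theorems.PercNearOneGluingNoHeavyLowerTailSahiOneStepFreeExtension
import HarnessLib

/-!
# One-step scheme: the free-coordinate step for `n` with a Hamming-threshold first slot

Prover prim-ineq-prove-3 gen 26 (`--supports stmt-CriticalPhenomena-4575`).  No definitions, no sorries.

For the first slot `H = {N_F ≥ t}` and a coordinate `e ∉ F`, `H` does not depend on `e` (`determinedBy_threshold_compl_singleton`),
so the free splitting identity `osN_ind_ind_free_split` applies: if the four pairs of sections of the increasing events `A`, `B` at
`e` satisfy `0 ≤ n`, then so does `(A, B)` (`osN_threshold_nonneg_of_sections`).  This is the induction step that removes, one at a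
time, the coordinates of `S_A ∪ S_B` lying outside the counted block `F` (used by `…OneSharedFree` and `…ThreeThresholds`).
-/

noncomputable section

namespace Summit.CriticalPhenomena.PercolationContinuityZ3.Theorems

namespace SahiOneStep

open MeasureTheory
open Literature.Probability.Percolation (DeterminedBy determinedBy_iff)
open Literature.Probability.LatticeModels (prodBernoulli)
open Literature.Probability.Percolation.DecisionTree (ind)
open scoped Classical

variable {ι : Type*}

/-- The Hamming-threshold slot `{N_F ≥ t}` does not depend on a coordinate outside the block `F`. [folklore] -/
theorem determinedBy_threshold_compl_singleton (F : Finset ι) (t : ℕ) {e : ι} (he : e ∉ F) :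
    DeterminedBy {ω : Set ι | t ≤ (F.filter (· ∈ ω)).card} ((({e} : Finset ι) : Set ι)ᶜ) := by
  rw [determinedBy_iff]
  intro ω ω' h
  simp only [Set.mem_setOf_eq]
  have hF : F.filter (· ∈ ω) = F.filter (· ∈ ω') := Finset.filter_congr fun i hi => by
    have hie : i ∈ ((({e} : Finset ι) : Set ι)ᶜ) := by
      rw [Finset.coe_singleton, Set.mem_compl_iff, Set.mem_singleton_iff]
      rintro rfl; exact he hi
    have := Set.ext_iff.1 h i
    simp only [Set.mem_inter_iff] at this
    constructor
    · intro h1; exact (this.1 ⟨h1, hie⟩).1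
    · intro h1; exact (this.2 ⟨h1, hie⟩).1
  rw [hF]

variable [Fintype ι]

/-- **Free-coordinate step for `n` with a threshold slot.**  If `e ∉ F` and the four pairs of sections of `A`, `B` at `e` satisfy
`0 ≤ n`, then so does `(A, B)` — by the free splitting identity `osN_ind_ind_free_split`, whose remaining term is nonnegative. [this work] -/
theorem osN_threshold_nonneg_of_sections (p : ι → unitInterval) (F : Finset ι) (t : ℕ) {A B : Set (Set ι)}
    (hA : IsUpperSet A) (hB : IsUpperSet B) {e : ι} (he : e ∉ F)
    (n11 : 0 ≤ osN p {ω : Set ι | t ≤ (F.filter (· ∈ ω)).card} (ind {ω : Set ι | insert e ω ∈ A}) (ind {ω : Set ι | insert e ω ∈ B}))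
    (n00 : 0 ≤ osN p {ω : Set ι | t ≤ (F.filter (· ∈ ω)).card} (ind {ω : Set ι | ω \ {e} ∈ A}) (ind {ω : Set ι | ω \ {e} ∈ B}))
    (n10 : 0 ≤ osN p {ω : Set ι | t ≤ (F.filter (· ∈ ω)).card} (ind {ω : Set ι | insert e ω ∈ A}) (ind {ω : Set ι | ω \ {e} ∈ B}))
    (n01 : 0 ≤ osN p {ω : Set ι | t ≤ (F.filter (· ∈ ω)).card} (ind {ω : Set ι | ω \ {e} ∈ A}) (ind {ω : Set ι | insert e ω ∈ B})) :
    0 ≤ osN p {ω : Set ι | t ≤ (F.filter (· ∈ ω)).card} (ind A) (ind B) := by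
  rw [osN_ind_ind_free_split p e (determinedBy_threshold_compl_singleton F t he) hA hB]
  have hpe0 : 0 ≤ (p e : ℝ) := (p e).2.1
  have hpe1 : (p e : ℝ) ≤ 1 := (p e).2.2
  have hH1 : (prodBernoulli p).real {ω : Set ι | t ≤ (F.filter (· ∈ ω)).card} ≤ 1 := by
    rw [← probReal_univ (μ := prodBernoulli p)]; exact measureReal_mono (Set.subset_univ _)
  have hlast : 0 ≤ (prodBernoulli p).real ({ω : Set ι | t ≤ (F.filter (· ∈ ω)).card} ∩
      ({ω : Set ι | insert e ω ∈ A} \ {ω : Set ι | ω \ {e} ∈ A}) ∩ ({ω : Set ι | insert e ω ∈ B} \ {ω : Set ι | ω \ {e} ∈ B})) :=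
    measureReal_nonneg
  have t1 : 0 ≤ (p e : ℝ) ^ 2 * osN p {ω : Set ι | t ≤ (F.filter (· ∈ ω)).card}
      (ind {ω : Set ι | insert e ω ∈ A}) (ind {ω : Set ι | insert e ω ∈ B}) := mul_nonneg (sq_nonneg _) n11
  have t2 : 0 ≤ (1 - p e : ℝ) ^ 2 * osN p {ω : Set ι | t ≤ (F.filter (· ∈ ω)).card}
      (ind {ω : Set ι | ω \ {e} ∈ A}) (ind {ω : Set ι | ω \ {e} ∈ B}) := mul_nonneg (sq_nonneg _) n00
  have t3 : 0 ≤ (p e : ℝ) * (1 - p e) * (osN p {ω : Set ι | t ≤ (F.filter (· ∈ ω)).card}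
      (ind {ω : Set ι | insert e ω ∈ A}) (ind {ω : Set ι | ω \ {e} ∈ B}) + osN p {ω : Set ι | t ≤ (F.filter (· ∈ ω)).card}
      (ind {ω : Set ι | ω \ {e} ∈ A}) (ind {ω : Set ι | insert e ω ∈ B})) :=
    mul_nonneg (mul_nonneg hpe0 (sub_nonneg.2 hpe1)) (add_nonneg n10 n01)
  have t4 : 0 ≤ (1 - (prodBernoulli p).real {ω : Set ι | t ≤ (F.filter (· ∈ ω)).card}) * ((p e : ℝ) * (1 - p e)) *
      (prodBernoulli p).real ({ω : Set ι | t ≤ (F.filter (· ∈ ω)).card} ∩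
      ({ω : Set ι | insert e ω ∈ A} \ {ω : Set ι | ω \ {e} ∈ A}) ∩ ({ω : Set ι | insert e ω ∈ B} \ {ω : Set ι | ω \ {e} ∈ B})) :=
    mul_nonneg (mul_nonneg (sub_nonneg.2 hH1) (mul_nonneg hpe0 (sub_nonneg.2 hpe1))) hlast
  linarith

end SahiOneStep

end Summit.CriticalPhenomena.PercolationContinuityZ3.Theorems
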